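import Summits.MatrixMultiplication.MatrixMultiplication.Theorems.AbelianSTPPCensusLeafTE127
import Summits.MatrixMultiplication.MatrixMultiplication.Theorems.AbelianSTPPCensusShapeExclusionTE

/-!
# Rung leaf F-M1.T_E/127 — CLOSED: no abelian STPP host of order ≤ 127 beats exponent 5/2

Cell mm-stpp (D-0046 (i)), route `AbelianSTPPCensus` (6/6 items proved, 2026-08-26T00:36Z).  The named,
unconditional kernel theorem `noAbelianSTPPHost_250_127 : NoAbelianSTPPHost_250_127`, i.e. for every finite
abelian group `H` with `|H| ≤ 127` and every STPP family `(A_i, B_i, C_i)_{i<N}` in `H` (CKSU 2005 Def. 5.1,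
tree `IsSTPP`), `Σ_i (|A_i||B_i||C_i|)^{5/6} ≤ |H|` — so no such host certifies `ω < 5/2` through the
Cohn–Umans / CKSU packing bound.  One line over the tree: the capstone
`AbelianTECensus.noAbelianSTPPHost_250_127_of_shapeExclusionTE` (sieve soundness vM + the nine residual
instances + assembly, theory gen 2) applied to the arithmetic crux `ShapeExclusionTE_proof`
(= `shapeExclusionTE_holds`, eng-2's verified certificate checker `ShapeCert.check`, `decide`-class kernel
evaluations, p413870/p414236).

WHAT THIS IS NOT: no bound on `ω`; a rung leaf (D-0061 ALT-CLOSER, class «rung leaf»), never summit credit;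
the census above order 127 is a separate matter (rule sets vN / vP).
-/

set_option linter.dupNamespace false -- `MatrixMultiplication.MatrixMultiplication` (summit = problem, D-0017)

namespace Summit.MatrixMultiplication.MatrixMultiplication.Theorems

/-- **Rung leaf T_E/127 (closed).** No finite abelian group of order at most `127` hosts an STPP family
beating exponent `5/2`: `Σ_i (|A_i||B_i||C_i|)^{5/6} ≤ |H|` for every STPP family in every such `H`. [original] -/
theorem noAbelianSTPPHost_250_127 : NoAbelianSTPPHost_250_127 :=
  AbelianTECensus.noAbelianSTPPHost_250_127_of_shapeExclusionTE ShapeExclusionTE_proof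

end Summit.MatrixMultiplication.MatrixMultiplication.Theorems
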